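import Summits.CriticalPhenomena.CardyFormulaZ2.Theses.UnionJackBeffara
import Summits.CriticalPhenomena.CardyFormulaZ2.Theorems.CardyFlipRussoCoveringLegWideBridge
import Summits.CriticalPhenomena.CardyFormulaZ2.Theorems.CardyIKTransportCrudeToCanonical
import HarnessLib

/-!
# `UnionJackBeffara.CoveringBridge` (crux item stmt-CriticalPhenomena-4560): proved

Route `UnionJackBeffara`, sub-problem `CriticalPhenomena/CardyFormulaZ2`, crux `CoveringBridge` (shared with route
`DWavePairKernel`): if the crude `P_{1/2,0}` crossing probability on Kesten's covering lattice `δG_s` of bond-`ℤ²`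
converges to Cardy's `F(η)` for EVERY conformal rectangle, then G02's `bondDomainCrossingProb R δ` (bond-`ℤ²` at
`½`, largest mesh component `Ω_δ`, discrete arcs by distance comparison) converges to `F(η)` for every `R`.

The proof is a composition of three results ALREADY in the tree (nothing is re-proved here):

* `wide_tendsto_sub` (Theorems/CardyFlipRussoCoveringLegWideBridge, Kesten's covering dictionary + the proved
  mesh-uniform crude-crossing continuity): for every `R`, `ujCrossingProb 0 R (√2·δ) − bondProb R δ → 0`, where
  `bondProb R δ` is the `P_{1/2}`-probability of the crude bond-`ℤ²` event
  `embDomainCrossing squareLatticeEmbedding.z R.carrier δ (R.arc 0) (R.arc 2)`;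
* `tendsto_comp_const_mul_iff` (Theorems/CardyFlipRussoCoveringLegTwins): a limit `δ → 0⁺` may be read at mesh
  `√2·δ`;
* `crudeToCanonical_proof` (Theorems/CardyIKTransportCrudeToCanonical, the CLOSED support item
  stmt-CriticalPhenomena-4968 of route `CardyIKTransport`): crude bond-`ℤ²` Cardy for EVERY conformal rectangle
  implies G02 Cardy for every conformal rectangle (Bollobás–Riordan Ch. 7 Lemma 14 sandwich with the lower comparison
  quad, Radó continuity, bond port of Claim 19).

Hence: UJ crude Cardy (all `R`) ⟹ crude bond-`ℤ²` Cardy (all `R`) ⟹ G02 Cardy (all `R`), which is the crux by name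
(`unionJackBeffara_coveringBridge_iff` re-signs the route decl over `ujCrossingProb`, by `rfl`).

References: H. Kesten, *Percolation theory for mathematicians* (1982) §3.4 [Kesten1982]; B. Bollobás, O. Riordan,
*Percolation* (2006) Ch. 7 Lemma 14 [BollobasRiordan2006]; O. Schramm, S. Smirnov, Ann. Probab. 39 (2011) Lemma 5.1
[SchrammSmirnov2011]; S. Smirnov, C. R. Acad. Sci. 333 (2001) §2 [Smirnov2001].
-/

noncomputable section

namespace Summit.CriticalPhenomena.CardyFormulaZ2.Theorems

open Filter Topology
open Literature.Probability.RandomPlanarGeometry hiding cardyFunction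
open Literature.Probability.Percolation hiding cardyFunction
open Summit.CriticalPhenomena.CardyFormulaZ2.Theses
open Summit.CriticalPhenomena.CardyFormulaZ2.Cruxes.CoveringLeg.FiveArmNull

/-- **Crude bond-`ℤ²` Cardy from Union-Jack crude Cardy.** If the crude `P_{1/2,0}` crossing probabilities
`ujCrossingProb 0 R` converge to Cardy's value for every conformal rectangle, then so do the crude bond-`ℤ²`
probabilities `bondProb R` (read the hypothesis at mesh `√2·δ` and subtract the proved covering null
`wide_tendsto_sub`). [cite: Kesten1982, §3.4] -/
theorem bondCardy_of_ujCardy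
    (h0 : ∀ R : ConformalRectangle, R.HasCrossingLimit (ujCrossingProb 0 R)
      Literature.Probability.RandomPlanarGeometry.cardyFunction)
    (R : ConformalRectangle) :
    R.HasCrossingLimit (bondProb R) Literature.Probability.RandomPlanarGeometry.cardyFunction := by
  intro φ x hφ
  have h1 : Tendsto (fun δ : ℝ => ujCrossingProb 0 R (Real.sqrt 2 * δ)) (𝓝[>] 0)
      (𝓝 (Literature.Probability.RandomPlanarGeometry.cardyFunction (crossRatio x))) :=
    (tendsto_comp_const_mul_iff (f := ujCrossingProb 0 R) (Real.sqrt_pos.2 two_pos)).2 (h0 R φ x hφ)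
  have h2 := h1.sub (wide_tendsto_sub R)
  rw [sub_zero] at h2
  refine h2.congr' (Eventually.of_forall fun δ => ?_)
  simp only [sub_sub_cancel]

/-- **`CoveringBridge` (crux item stmt-CriticalPhenomena-4560), proved.** Union-Jack crude `P_{1/2,0}` Cardy for
every conformal rectangle implies G02's `bondDomainCrossingProb R δ → F(η_R)` for every conformal rectangle `R`:
`bondCardy_of_ujCardy` (Kesten's covering dictionary, `wide_tendsto_sub`) followed by the tree's global
discretisation bridge `crudeToCanonical_proof` (stmt-CriticalPhenomena-4968, Bollobás–Riordan Ch. 7 Lemma 14).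
[cite: Kesten1982, §3.4] [cite: BollobasRiordan2006, Ch. 7 Lemma 14] -/
theorem coveringBridge_proof : UnionJackBeffara.CoveringBridge := by
  rw [unionJackBeffara_coveringBridge_iff]
  intro h0
  exact crudeToCanonical_proof fun R => bondCardy_of_ujCardy h0 R

end Summit.CriticalPhenomena.CardyFormulaZ2.Theorems

end
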